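import Summits.HodgeConjecture.HodgeConjecture.Theorems.HeckePrymWeilHeckePrymAnchorsUpgrade
import Literature.AlgebraicGeometry.HodgeTheory.WeilClassesFourfolds
import Literature.AlgebraicGeometry.Motives.AbelianVarietyProjectiveChart
import Summits.HodgeConjecture.HodgeConjecture.Theses.HeckePrymWeil
import HarnessLib

/-!
# Crux `WeilTwelvefoldsSqrtMinus7` (stmt-HodgeConjecture-1261), line `polya-glued-box-products` ·
# stub `stub_weilFourfoldsTyped`: the typing bridge from Markman's fourfold theorem (CONDITIONAL)

Route `HeckePrymWeil` (sub-problem `HodgeConjecture`); lead seat c7 of crux `WeilTwelvefoldsSqrtMinus7`,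
line `polya-glued-box-products`, registered stub 2 `stub_weilFourfoldsTyped`.

The stub asks: on every complex abelian FOURFOLD `W` with `ψ ≫ ψ = -7`, every rational `(2,2)`-class of
the ROUTE's typed Weil span `Eig((𝟙+ψ)^*, (1+i√7)⁴) ⊔ Eig((𝟙+ψ)^*, (1-i√7)⁴) ⊆ H⁴(W(ℂ); ℂ)` is
algebraic (Markman, arXiv:2509.23403 Thm. 1.2 and §11.5 Step 2; arXiv:2502.03415 Cor. 1.6.1 — every
discriminant).  In the tree Markman's theorem is the NAMED FACT
`Literature.AlgebraicGeometry.HodgeTheory.Markman2025_weilClasses_algebraic_abelianFourfold`, typed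
over the STRONG Weil plane `weilClassesOf W ψ 2 d` (joint eigenclasses of every `(x·𝟙 + y·ψ)^*`) with
`d : ℕ`, `0 < d`, `W.dim = 2 * 2`, `Motives.IsSmoothProjective (2 * 2) W.X`, `ψ ≫ ψ = -(d • 𝟙 W)`.
That named fact has NO `_holds` in the tree (its proof is Markman's secant-sheaf theorem).

This file is therefore CONDITIONAL on the named fact `Markman2025_weilClasses_algebraic_abelianFourfold`:
it proves the typing BRIDGE `weilFourfoldsTyped_of_markman` (named fact ⟹ the stub's exact
signature), and nothing more; the unconditional registered stub `stub_weilFourfoldsTyped` waits on the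
named fact.  The bridge's own ingredients are all PROVED in the tree:

* the typing upgrade typed plane `≤` strong plane, `HeckePrymWeilLine.stub_upgrade` at `p = 7`, `k = 2`
  (`H⁴ = ⋀⁴H¹` on the real carriers and the eigenvalue separation `(1-θ)/(1+θ)` no root of unity);
* smooth projectivity of `W.X`, `Motives.AbelianVariety.isSmoothProjective_holds`;
* the casts `4 = 2 * 2`, `((7 : ℕ) : ℤ) • 𝟙 W = (7 : ℤ) • 𝟙 W = ↑((7 : ℕ) • 𝟙 W)`.

No `sorry`, no new definition, no hypothesis beyond the named fact.
-/

noncomputable section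

-- every declaration of this problem lives in `Summit.HodgeConjecture.HodgeConjecture.…` (summit = sub-problem)
set_option linter.dupNamespace false

open CategoryTheory AlgebraicGeometry

namespace Summit.HodgeConjecture.HodgeConjecture.Theorems.WeilTwelvefoldsSqrtMinus7.PolyaGluedBoxProducts

open Literature.AlgebraicGeometry Literature.AlgebraicGeometry.Motives Literature.AlgebraicGeometry.HodgeTheory
open Literature.AlgebraicTopology.SingularHomology

/-- **Markman 2025 for `ℚ(√-7)` fourfolds in the ROUTE's typing, CONDITIONAL on the named fact.**
Granted `Markman2025_weilClasses_algebraic_abelianFourfold` (rational `(2,2)`-classes of the strong Weil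
plane `weilClassesOf W ψ 2 d` of a complex abelian fourfold with `ψ ≫ ψ = -d` are algebraic, every
`d ≥ 1`), every rational `(2,2)`-class of the single-operator typed span
`Eig((𝟙+ψ)^*, (1+i√7)⁴) ⊔ Eig((𝟙+ψ)^*, (1-i√7)⁴)` of a complex abelian fourfold `W` with `ψ ≫ ψ = -7`
is algebraic: the typed span lies in `weilClassesOf W ψ 2 7` (`HeckePrymWeilLine.stub_upgrade`,
`p = 7` prime, `7 % 4 = 3`, `k = 2`) and `W.X` is smooth projective of dimension `2 * 2`
(`AbelianVariety.isSmoothProjective_holds`).  This is exactly the registered signature of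
`stub_weilFourfoldsTyped` behind the one hypothesis.
[cite: Markman2025SurveySecant, Thm. 1.2 and §11.5 Step 2] -/
theorem weilFourfoldsTyped_of_markman
    (hM : Markman2025_weilClasses_algebraic_abelianFourfold) :
    ∀ (W : AbelianVariety ℂ) (ψ : W ⟶ W), W.dim = 4 → ψ ≫ ψ = -((7 : ℤ) • 𝟙 W) →
    ∀ c : complexBetti W.X 4, IsRationalClass c → IsOfHodgeType 4 W.X 4 2 2 c →
      c ∈ Module.End.eigenspace (complexBetti.map (𝟙 W + ψ).hom.hom.hom 4).hom
            ((1 + Complex.I * (Real.sqrt (7 : ℝ) : ℂ)) ^ 4) ⊔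
          Module.End.eigenspace (complexBetti.map (𝟙 W + ψ).hom.hom.hom 4).hom
            ((1 - Complex.I * (Real.sqrt (7 : ℝ) : ℂ)) ^ 4) →
      c ∈ algebraicClasses W.X 2 := by
  intro W ψ hW hψ c hrat hH hc
  have h7 : Nat.Prime 7 := by norm_num
  have hW' : W.dim = 2 * 2 := by rw [hW]
  have hψ' : ψ ≫ ψ = -(((7 : ℕ) : ℤ) • 𝟙 W) := by exact_mod_cast hψ
  have hψ'' : ψ ≫ ψ = -((7 : ℕ) • 𝟙 W) := by rw [hψ, ← natCast_zsmul]; rfl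
  -- typing upgrade: the typed plane lies in the strong Weil plane of `(W, ψ)`
  have hcW : c ∈ weilClassesOf W ψ 2 7 :=
    HeckePrymWeilLine.stub_upgrade 7 h7 (by norm_num) le_rfl 2 W ψ hW' hψ' (by exact_mod_cast hc)
  -- smooth projectivity of the abelian fourfold (proved in the tree)
  have hsp : IsSmoothProjective (2 * 2) W.X := hW' ▸ AbelianVariety.isSmoothProjective_holds (A := W)
  exact hM 7 (by norm_num) W ψ hW' hsp hψ'' c hrat hH hcW

end Summit.HodgeConjecture.HodgeConjecture.Theorems.WeilTwelvefoldsSqrtMinus7.PolyaGluedBoxProducts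

end
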